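import Literature.MathematicalPhysics.QuantumFieldTheory.Balaban1983to89.B9Eq327GreenZdHermPer
import Literature.MathematicalPhysics.QuantumFieldTheory.Balaban1983to89.B8Eq191FlatStencils
import Literature.MathematicalPhysics.QuantumFieldTheory.TorusChartFlatCochains

/-!
# `Balaban1983to89.B9Eq172FlatCurlPoincareZdPer` — [Balaban1984PropagatorsI] p. 30 (the sentence after (1.72)) and [Balaban1985BackgroundPropagators]
# (3.3)–(3.4) p. 391 AT THE FLAT BACKGROUND ON THE TORUS `T_η` READ ON `ℤᵈ`: THE POINCARÉ LEMMA FOR `P`-PERIODIC BOND FIELDS — a `P`-periodic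
# `𝔸`-valued bond field with vanishing flat plaquette derivative `(D^η_1 A)(p) = 0` is a flat pure gauge plus a constant vector function,
# `A = D^η_1 λ + A₀`, with `λ` `P`-periodic (Hermitian data for Hermitian `A`), the constant `A₀` being the cell average of `A`; and `D^η_1 λ ≡ 0`
# with `λ` periodic forces `λ` to be constant

statement-level skeleton of published theorems with citation tags; proofs where landed; nothing here is a claim about the
Yang–Mills mass gap

`[Balaban1984PropagatorsI]` ("B5", CMP **95** (1984) 17–40) p. 30: *«Thus if for some A we have Δ_aA = 0, then ΔA − dPd*A = 0, QA = 0. (1.72) From the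
first equation we get A = ∂Δ⁻²Q′*(Q′Δ⁻²Q′*)⁻¹ω + A₀ where A₀ is a constant vector function and ω is a function on unit lattice T₁^{(k)} orthogonal to
constant functions.»*; p. 22 *«Constant functions form the eigenspace corresponding to the eigenvalue 0»*.  `[Balaban1985BackgroundPropagators]` ("B9",
CMP **99** (1985) 389–434) (3.3) p. 391 *«(D^η_{U₀}λ)(b) = η⁻¹(R(U₀(b))λ(b₊) − λ(b₋))»*, (3.4) p. 391 (the plaquette derivative), Thm 3.11 p. 416
(positivity of `Δ_a(U)`; at `U = 1` «G_□(1) is positive»).  `[Balaban1985RegularSpaces]` ("B8", CMP **99** (1985) 75–102) p. 77 *«we admit the case when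
some domains Ω_j are equal to T_η»* (the torus datum).  PDF held: `paper:balaban1984-cmp95-propagators-rt-i` p. 30, `paper:balaban1985-cmp99-background-
propagators` pp. 391, 416 (via the tree's `B5Eq172PoincareTorus` ∕ `B9Eq327GreenZdHermPer` docstrings, re-read 2026-08-28).

CITATION HEADER (lean-in-tree rule).  Cell `pub-ymgap` (YM Track A, HUMAN RULINGS D-0062 ∕ D-0149), node N06 = [B9], width seat `pub-ymgap-dag-n06-w3`
(g6), CLAIM-1 ∕ INTENT-1 (bus 2026-08-28 14:00Z).  WHY.  On the (β′-PERIODIC) road of record (director-ym №217; plan g86 PENS-217) the N06 object layer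
is `B9Eq327GreenZdHermPer` (dag-n06-b g22): the periodic Hermitian carrier `E_𝔤^per(P)` = `domSubHPer P`, the qualitative Thm 3.11 conclusion
`RegularAtHPer`, and the energy identity `sum_box_pair_Jcur` (the `D*D` square on the torus cell).  The FLAT KERNEL of the genuine record on the torus —
«`‖D¹A‖² + ‖R(1)D¹*A‖² + a‖Q_k(1)A‖² = 0 ⇒ A = 0`», the A6 inhabitant of the periodic Thm 3.11 binder at `U₀ = 1` and the flat end of the continuity ∕
near-flat roads — starts with print's sentence after (1.72): a curl-free bond field on the torus is a gradient plus a constant.  The NE9 chain proved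
that sentence for its own torus carrier (`B5Eq172PoincareTorus.exists_eq_covDeriv_add_const` on `B4Sect5Torus.TSite`); the N06 junction reads the
torus as `P`-PERIODIC fields on `ℤᵈ` (`T4TermwiseTorus.IsPeriodic`, `B7Prop1Explicit.Site`, the stencils `B8Ineq132.covDerivFwd` ∕
`B8Eq146AExpansion.plaqCovDeriv`).  THIS FILE transports the generic structure theorem for flat `1`-cochains on a charted torus
(`TorusChartFlatCochains.exists_d₀_eq_iff`, `eq_d₀_prim_add_seam_wind`) through the chart `TorusChart.pi d P` of `(ℤ∕P)ᵈ` to that reading.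

WHAT IS PROVED (kernel, 0 sorry, 0 def; [folklore] discrete exterior calculus — the cited sentences are print's use of it).
* §1 dictionary `ℤᵈ`-periodic ↔ `(ℤ∕P)ᵈ`: `tcls_e` (`[e_μ] = δ_μ`), `apply_tlift_add_single` (a periodic field read at `ξ + δ_μ` is read at the
  representative `+ e_μ`), `tlift_zero`, `isPeriodic_comp_tcls`, `plaqCovDeriv_one_apply` ((3.4) at `U₀ = 1` as ONE difference; the forward derivative (3.3) at `U₀ = 1` is `B8Eq191FlatStencils.covDerivFwd_flat_apply`, USED), `d₁_read_eq_smul_plaqCovDeriv_one`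
  (the chart's plaquette circulation of the reading of `A` is `η·(D^η_1A)(p)`), `isFlat_read_of_plaqCovDeriv_one_eq_zero`, `wind_const_pi`.
* §2 ★★ `exists_periodic_potential_add_const_of_flat` (THE POINCARÉ LEMMA, p. 30): `A` `P`-periodic, `(D^η_1A)(p) = 0` at every plaquette, `η ≠ 0` ⟹
  `A(x)_μ = (D^η_{1,μ}λ)(x) + v_μ` with `λ` `P`-periodic; ★★ `exists_herm_periodic_potential_add_const_of_flat`: for `A ∈ E_𝔤^per(P)` (periodic AND
  Hermitian) the data `λ`, `v` are Hermitian; ★ `plaqCovDeriv_one_covDerivFwd_add_const` (converse: such fields ARE flat — A6 for the hypothesis).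
* §3 ★ `periodic_eq_const_of_covDerivFwd_one_eq_zero` (p. 22: a periodic `λ` with `D^η_1λ ≡ 0` is constant), ★ `sum_box_covDerivFwd_one` (a periodic flat
  gradient has zero cell sum — «ω ⊥ constants», p. 27∕30), ★★ `card_smul_const_eq_sum_box_of_flat` (the constant part is pinned: `Pᵈ·v_μ = Σ_{x∈[0,P)ᵈ} A(x)_μ`),
  `plaqCovDeriv_one_eq_zero_of_lt_of_mem_box` (flatness everywhere from flatness on the cell's plaquettes `ν < κ`, the index range of `sum_box_pair_Jcur`).

HONEST SCOPE.  Count-neutral helper (`--supports` the K1 item of record): [folklore] lattice calculus transported to the N06 periodic carrier; NO estimate of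
[B9]; Thm 3.11 ∕ 3.3 NOT proved; the `R(1)` ∕ `Q_k(1)` halves of the flat kernel statement are NOT here (they wait on the periodic Landau ∕ averaging
letters of dag-n06-w4 ∕ dag-n06-b); N05 ∕ N06 NOT discharged; K1 NOT closed; one finite `𝕋⁴` programme at fixed `ε`, Bałaban as printed; R4 closes only the
conditional finite-`𝕋⁴` rung `BalabanLadder.UV` — nothing continuum ∕ ℝ⁴ ∕ OS ∕ mass gap ∕ Clay.  Unit `pub-ymgap-dag-n06-w3` (g6), 2026-08-28; NEW file
importing `B9Eq327GreenZdHermPer`, `B8Eq191FlatStencils` and `TorusChartFlatCochains`; modifies nothing.  Net new unproved facts: 0.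
-/

noncomputable section

open scoped BigOperators

namespace Literature.MathematicalPhysics.QuantumFieldTheory.Balaban1983to89.B9Eq172FlatCurlPoincareZdPer

open B7Prop1Explicit B7Eq78Linearization
open B8Ineq132 (covDerivFwd)
open B8Eq146AExpansion (plaqCovDeriv plaqCovDeriv_eq_covDerivFwd)
open B8Eq191FlatStencils (covDerivFwd_flat_apply)
open T4TermwiseTorus (IsPeriodic box tcls tlift tcls_add tcls_period tcls_tlift tlift_mem_box tlift_tcls_of_mem_box card_box)
open B9Eq327GreenZdHerm (hermPart hermPart_of_isSelfAdjoint isSelfAdjoint_hermPart hermPart_add hermPart_smul)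
open B9Eq327GreenZdHermPer (domSubHPer mem_domSubHPer_iff sum_box_shift)
open Literature.MathematicalPhysics.QuantumFieldTheory (TorusChart)

-- `Site` alone could resolve to the torus sites of `Setup.lean`; re-export the `ℤ^d` sites of `B7Prop1Explicit`.
export B7Prop1Explicit (Site)

variable {d : ℕ} {𝔸 : Type*} [CStarAlgebra 𝔸]

/-! ## §1  The dictionary: `P`-periodic fields on `ℤᵈ` read on the charted torus `(ℤ∕P)ᵈ` -/

section Dictionary

variable (P : ℕ)

omit [CStarAlgebra 𝔸] in
/-- the torus class of the unit vector `e_μ ∈ ℤᵈ` is the chart generator `δ_μ` of `TorusChart.pi d P` (reading `T_η` on `ℤᵈ`; bookkeeping).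
[cite: Balaban1985RegularSpaces, p.77 («Ω_j = T_η»; bookkeeping)] -/
theorem tcls_e (μ : Fin d) : tcls P (e μ : Site d) = Pi.single μ 1 := by
  funext κ
  rw [T4TermwiseTorus.tcls_apply, e_apply, Pi.single_apply]
  split_ifs <;> simp

omit [CStarAlgebra 𝔸] in
/-- the representative of the torus class `0` is `0 ∈ ℤᵈ` (reading `T_η` on `ℤᵈ`; bookkeeping). [cite: Balaban1985RegularSpaces, p.77 («Ω_j = T_η»; bookkeeping)] -/
theorem tlift_zero [NeZero P] : tlift (0 : Fin d → ZMod P) = (0 : Site d) := by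
  funext κ
  simp [tlift]

omit [CStarAlgebra 𝔸] in
/-- **a periodic field read on the torus**: its value at the representative of `ξ + δ_μ` is its value at (representative of `ξ`) `+ e_μ` — the chart's
unit step is the lattice unit step (reading `T_η` on `ℤᵈ`; bookkeeping). [cite: Balaban1985RegularSpaces, p.77 («Ω_j = T_η»; bookkeeping)] -/
theorem apply_tlift_add_single [NeZero P] {β : Sort*} {F : Site d → β} (hF : IsPeriodic P F) (ξ : Fin d → ZMod P) (μ : Fin d) :
    F (tlift (ξ + Pi.single μ 1)) = F (tlift ξ + e μ) :=
  hF.eq_of_tcls_eq (by rw [tcls_tlift, tcls_add, tcls_tlift, tcls_e])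

omit [CStarAlgebra 𝔸] in
/-- a function of the torus class is periodic: `x ↦ g [x]` is `P`-periodic (reading `T_η` on `ℤᵈ`; bookkeeping).
[cite: Balaban1985RegularSpaces, p.77 («Ω_j = T_η»; bookkeeping)] -/
theorem isPeriodic_comp_tcls {β : Sort*} (g : (Fin d → ZMod P) → β) : IsPeriodic P fun x : Site d => g (tcls P x) := fun x m => by
  simp only [tcls_add, tcls_period, add_zero]

/-- **(3.4) AT THE FLAT BACKGROUND**: `(D^η_1 A)(p_{μν}(x)) = η⁻¹(A(x)_μ + A(x + e_μ)_ν − A(x + e_ν)_μ − A(x)_ν)`.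
[cite: Balaban1985BackgroundPropagators, (3.4) p.391] -/
theorem plaqCovDeriv_one_apply (η : ℝ) (A : Site d → Fin d → 𝔸) (μ ν : Fin d) (x : Site d) :
    plaqCovDeriv η (1 : Site d → Fin d → 𝔸ˣ) A μ ν x = η⁻¹ • (A x μ + A (x + e μ) ν - A (x + e ν) μ - A x ν) := by
  rw [plaqCovDeriv_eq_covDerivFwd, covDerivFwd_flat_apply, covDerivFwd_flat_apply, ← smul_sub]
  congr 1
  abel

/-- the flat plaquette derivative is antisymmetric in the two directions (also `Node00.TorusCoverPropSixGauge10.plaqCovDeriv_one_swap`, not in this import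
cone). [cite: Balaban1985BackgroundPropagators, (3.4) p.391] -/
private theorem plaqCovDeriv_one_swap (η : ℝ) (A : Site d → Fin d → 𝔸) (μ ν : Fin d) (x : Site d) :
    plaqCovDeriv η (1 : Site d → Fin d → 𝔸ˣ) A ν μ x = -plaqCovDeriv η (1 : Site d → Fin d → 𝔸ˣ) A μ ν x := by
  rw [plaqCovDeriv_one_apply, plaqCovDeriv_one_apply, ← smul_neg]
  congr 1
  abel

/-- the flat plaquette derivative vanishes on the diagonal `μ = ν`. [cite: Balaban1985BackgroundPropagators, (3.4) p.391] -/
private theorem plaqCovDeriv_one_self (η : ℝ) (A : Site d → Fin d → 𝔸) (μ : Fin d) (x : Site d) :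
    plaqCovDeriv η (1 : Site d → Fin d → 𝔸ˣ) A μ μ x = 0 := by
  rw [plaqCovDeriv_one_apply]
  have : A x μ + A (x + e μ) μ - A (x + e μ) μ - A x μ = 0 := by abel
  rw [this, smul_zero]

/-- **THE CHART'S PLAQUETTE CIRCULATION OF THE READING OF `A` IS `η·(D^η_1A)(p)`**: for a periodic bond field `A` read on `(ℤ∕P)ᵈ` as
`θ(ξ)_μ = A(tlift ξ)_μ`, `d₁θ(ξ; μ, ν) = η • (D^η_1A)(p_{μν}(tlift ξ))` (`η ≠ 0`). [cite: Balaban1985BackgroundPropagators, (3.4) p.391] -/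
theorem d₁_read_eq_smul_plaqCovDeriv_one [NeZero P] {η : ℝ} (hη : η ≠ 0) {A : Site d → Fin d → 𝔸} (hA : IsPeriodic P A)
    (ξ : Fin d → ZMod P) (μ ν : Fin d) :
    (TorusChart.pi d P).d₁ (fun ζ κ => A (tlift ζ) κ) ξ μ ν = η • plaqCovDeriv η (1 : Site d → Fin d → 𝔸ˣ) A μ ν (tlift ξ) := by
  rw [TorusChart.d₁_apply, TorusChart.pi_gen, TorusChart.pi_gen, plaqCovDeriv_one_apply, smul_smul, mul_inv_cancel₀ hη, one_smul]
  have hμ : A (tlift (ξ + Pi.single μ 1)) = A (tlift ξ + e μ) := apply_tlift_add_single P hA ξ μ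
  have hν : A (tlift (ξ + Pi.single ν 1)) = A (tlift ξ + e ν) := apply_tlift_add_single P hA ξ ν
  rw [hμ, hν]

/-- **FLAT ON `ℤᵈ` ⟹ FLAT ON THE CHART**: if `(D^η_1A)(p) = 0` at every plaquette then the reading of `A` is a flat `1`-cochain of `TorusChart.pi d P`.
[cite: Balaban1985BackgroundPropagators, (3.4) p.391] -/
theorem isFlat_read_of_plaqCovDeriv_one_eq_zero [NeZero P] {η : ℝ} (hη : η ≠ 0) {A : Site d → Fin d → 𝔸} (hA : IsPeriodic P A)
    (hflat : ∀ (μ ν : Fin d) (x : Site d), plaqCovDeriv η (1 : Site d → Fin d → 𝔸ˣ) A μ ν x = 0) :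
    (TorusChart.pi d P).IsFlat (fun ζ κ => A (tlift ζ) κ) := fun ξ μ ν => by
  rw [d₁_read_eq_smul_plaqCovDeriv_one P hη hA, hflat, smul_zero]

omit [CStarAlgebra 𝔸] in
/-- the winding vector of a constant cochain `(ξ, μ) ↦ v_μ` on `TorusChart.pi d P` is `P • v` — print's «constant vector function `A₀`» winds `P` times
its value around each axis (bookkeeping). [cite: Balaban1984PropagatorsI, (1.72) p.30 («A₀ is a constant vector function»; bookkeeping)] -/
theorem wind_const_pi [NeZero P] {V : Type*} [AddCommGroup V] (v : Fin d → V) (μ : Fin d) :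
    (TorusChart.pi d P).wind (fun (_ : Fin d → ZMod P) (ν : Fin d) => v ν) μ = P • v μ := by
  rw [TorusChart.wind_eq, TorusChart.lineSum, Finset.sum_const, Finset.card_range, TorusChart.pi_period]

end Dictionary

/-! ## §2  The Poincaré lemma for periodic bond fields at the flat background -/

section Poincare

variable (P : ℕ) [NeZero P] {η : ℝ}

/-- ★★ **THE TORUS POINCARÉ LEMMA READ ON `ℤᵈ`** ([B5] p. 30, the sentence after (1.72): «A = ∂(…)ω + A₀ where A₀ is a constant vector function»):
a `P`-periodic bond field `A` on `ℤᵈ` with `(D^η_1 A)(p) = 0` at every plaquette is `A(x)_μ = (D^η_{1,μ}λ)(x) + v_μ` for a `P`-PERIODIC site function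
`λ` and a constant vector `v` (`η ≠ 0`).  MECHANISM: the reading of `A` on `(ℤ∕P)ᵈ` is a flat cochain of the chart `TorusChart.pi d P`; subtracting the
constant cochain `P⁻¹ • (winding vector)` kills the winding, and a flat cochain with zero winding is a gradient (`TorusChartFlatCochains.exists_d₀_eq_iff`);
pull the potential back along `x ↦ [x]` and rescale by `η`. [cite: Balaban1984PropagatorsI, (1.72) p.30; Balaban1985BackgroundPropagators, (3.3)–(3.4) p.391] -/
theorem exists_periodic_potential_add_const_of_flat (hη : η ≠ 0) {A : Site d → Fin d → 𝔸} (hA : IsPeriodic P A)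
    (hflat : ∀ (μ ν : Fin d) (x : Site d), plaqCovDeriv η (1 : Site d → Fin d → 𝔸ˣ) A μ ν x = 0) :
    ∃ (lam : Site d → 𝔸) (v : Fin d → 𝔸), IsPeriodic P lam ∧
      ∀ (x : Site d) (μ : Fin d), A x μ = covDerivFwd η (1 : Site d → Fin d → 𝔸ˣ) μ lam x + v μ := by
  classical
  set F : TorusChart (Fin d → ZMod P) d := TorusChart.pi d P with hFdef
  set θ : (Fin d → ZMod P) → Fin d → 𝔸 := fun ζ κ => A (tlift ζ) κ with hθdef
  have hθ : F.IsFlat θ := isFlat_read_of_plaqCovDeriv_one_eq_zero P hη hA hflat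
  -- the constant cochain carrying the winding vector
  set c : Fin d → 𝔸 := fun μ => ((P : ℕ) : ℝ)⁻¹ • F.wind θ μ with hcdef
  have hP : ((P : ℕ) : ℝ) ≠ 0 := Nat.cast_ne_zero.2 (NeZero.ne P)
  have hcflat : F.IsFlat (fun (_ : Fin d → ZMod P) (ν : Fin d) => c ν) := fun ξ μ ν => by
    rw [TorusChart.d₁_apply]; abel
  have hcwind : F.wind (fun (_ : Fin d → ZMod P) (ν : Fin d) => c ν) = F.wind θ := by
    funext μ
    rw [hFdef, wind_const_pi P c μ, hcdef]
    dsimp only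
    rw [← Nat.cast_smul_eq_nsmul ℝ, smul_smul, mul_inv_cancel₀ hP, one_smul]
  -- the residual is flat with zero winding, hence a gradient
  have hres : F.IsFlat (θ - fun _ ν => c ν) ∧ F.wind (θ - fun _ ν => c ν) = 0 :=
    ⟨hθ.sub hcflat, by rw [TorusChart.wind_sub, hcwind, sub_self]⟩
  obtain ⟨f, hf⟩ := (F.exists_d₀_eq_iff (θ - fun _ ν => c ν)).2 hres
  refine ⟨fun x => η • f (tcls P x), c, fun x m => by simp only [tcls_add, tcls_period, add_zero], fun x μ => ?_⟩
  -- read `A x μ` on the torus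
  have hread : A x μ = θ (tcls P x) μ := by
    rw [hθdef]; exact (congr_fun (hA.apply_tlift x) μ).symm
  have hdec : θ (tcls P x) μ = F.d₀ f (tcls P x) μ + c μ := by
    have := congr_fun (congr_fun hf (tcls P x)) μ
    rw [Pi.sub_apply, Pi.sub_apply, sub_eq_iff_eq_add] at this
    exact this
  rw [hread, hdec, covDerivFwd_flat_apply, TorusChart.d₀_apply, hFdef, TorusChart.pi_gen, ← smul_sub, smul_smul, inv_mul_cancel₀ hη, one_smul,
    tcls_add, tcls_e]

/-- `hermPart` is subtractive. [folklore] -/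
private theorem hermPart_sub' (a b : 𝔸) : hermPart (a - b) = hermPart a - hermPart b := by
  rw [sub_eq_add_neg, hermPart_add, ← neg_one_smul ℝ b, hermPart_smul, neg_one_smul, ← sub_eq_add_neg]

/-- ★★ **THE POINCARÉ LEMMA ON THE HERMITIAN PERIODIC CARRIER `E_𝔤^per(P)`**: for `A ∈ domSubHPer P` (periodic with Hermitian = `𝔤`-valued
entries, [B9] p. 391) with `(D^η_1 A)(p) = 0` everywhere, the potential `λ` and the constant `v` can be taken HERMITIAN: `A(x)_μ = (D^η_{1,μ}λ)(x) +
v_μ`, `λ` `P`-periodic with `λ(x)* = λ(x)`, `v_μ* = v_μ` (take Hermitian parts: `D^η_1` at the flat background is real-linear and commutes with `*`).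
[cite: Balaban1984PropagatorsI, (1.72) p.30; Balaban1985BackgroundPropagators, (3.3)–(3.4) p.391, (3.27) p.395] -/
theorem exists_herm_periodic_potential_add_const_of_flat (hη : η ≠ 0) {A : Site d → Fin d → 𝔸}
    (hA : A ∈ domSubHPer (d := d) (𝔸 := 𝔸) P)
    (hflat : ∀ (μ ν : Fin d) (x : Site d), plaqCovDeriv η (1 : Site d → Fin d → 𝔸ˣ) A μ ν x = 0) :
    ∃ (lam : Site d → 𝔸) (v : Fin d → 𝔸), IsPeriodic P lam ∧ (∀ x, IsSelfAdjoint (lam x)) ∧ (∀ μ, IsSelfAdjoint (v μ)) ∧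
      ∀ (x : Site d) (μ : Fin d), A x μ = covDerivFwd η (1 : Site d → Fin d → 𝔸ˣ) μ lam x + v μ := by
  obtain ⟨lam₀, v₀, hper, hdec⟩ := exists_periodic_potential_add_const_of_flat P hη hA.1 hflat
  refine ⟨fun x => hermPart (lam₀ x), fun μ => hermPart (v₀ μ), fun x m => ?_, fun x => isSelfAdjoint_hermPart _,
    fun μ => isSelfAdjoint_hermPart _, fun x μ => ?_⟩
  · simp only [hper x m]
  · have h := congrArg hermPart (hdec x μ)
    rw [hermPart_of_isSelfAdjoint (hA.2 x μ), hermPart_add, covDerivFwd_flat_apply, hermPart_smul, hermPart_sub'] at h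
    rw [h, covDerivFwd_flat_apply]

/-- ★ **CONVERSE (A6 for the hypothesis)**: a flat pure gauge plus a constant, `A(x)_μ = (D^η_{1,μ}λ)(x) + v_μ`, HAS vanishing flat plaquette derivative —
`D^η_1 ∘ D^η_1 = 0` at `U₀ = 1` and constants are curl-free. [cite: Balaban1985BackgroundPropagators, (3.3)–(3.4) p.391] -/
theorem plaqCovDeriv_one_covDerivFwd_add_const (η : ℝ) (lam : Site d → 𝔸) (v : Fin d → 𝔸) (μ ν : Fin d) (x : Site d) :
    plaqCovDeriv η (1 : Site d → Fin d → 𝔸ˣ) (fun y κ => covDerivFwd η (1 : Site d → Fin d → 𝔸ˣ) κ lam y + v κ) μ ν x = 0 := by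
  rw [plaqCovDeriv_one_apply]
  simp only [covDerivFwd_flat_apply]
  rw [add_right_comm x (e ν) (e μ)]
  have : η⁻¹ • (lam (x + e μ) - lam x) + v μ + (η⁻¹ • (lam (x + e μ + e ν) - lam (x + e μ)) + v ν) -
      (η⁻¹ • (lam (x + e μ + e ν) - lam (x + e ν)) + v μ) - (η⁻¹ • (lam (x + e ν) - lam x) + v ν) = 0 := by
    simp only [smul_sub]
    abel
  rw [this, smul_zero]

end Poincare

/-! ## §3  Constants: `D^η_1λ ≡ 0` forces a periodic `λ` to be constant; the constant part is the cell average -/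

section Constants

variable (P : ℕ) [NeZero P] {η : ℝ}

/-- ★ **A PERIODIC SITE FUNCTION WITH VANISHING FLAT GRADIENT IS CONSTANT** ([B5] p. 22: the kernel of the torus Laplacian ∕ gradient is the constants):
`(D^η_{1,μ}λ)(x) = 0` for all `μ, x` and `λ` `P`-periodic ⟹ `λ(x) = λ(0)` — the torus is connected by unit steps (`TorusChartFlatCochains.d₀_eq_zero_iff`).
[cite: Balaban1984PropagatorsI, p.22; Balaban1985BackgroundPropagators, (3.3) p.391] -/
theorem periodic_eq_const_of_covDerivFwd_one_eq_zero (hη : η ≠ 0) {lam : Site d → 𝔸} (hlam : IsPeriodic P lam)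
    (hD : ∀ (μ : Fin d) (x : Site d), covDerivFwd η (1 : Site d → Fin d → 𝔸ˣ) μ lam x = 0) (x : Site d) : lam x = lam 0 := by
  set F : TorusChart (Fin d → ZMod P) d := TorusChart.pi d P with hFdef
  have hd₀ : F.d₀ (fun ζ => lam (tlift ζ)) = 0 := by
    funext ξ μ
    have h := hD μ (tlift ξ)
    rw [covDerivFwd_flat_apply, smul_eq_zero, inv_eq_zero] at h
    rw [TorusChart.d₀_apply, hFdef, TorusChart.pi_gen, apply_tlift_add_single P hlam, Pi.zero_apply, Pi.zero_apply]
    exact h.resolve_left hη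
  have h := (F.d₀_eq_zero_iff _).1 hd₀ (tcls P x)
  rwa [hlam.apply_tlift, tlift_zero P] at h

/-- ★ **A PERIODIC FLAT GRADIENT HAS ZERO CELL SUM** («ω orthogonal to constant functions», [B5] pp. 27∕30): `Σ_{x ∈ [0,P)ᵈ} (D^η_{1,μ}λ)(x) = 0` for a
`P`-periodic `λ` — the cell sum is translation invariant (`B9Eq327GreenZdHermPer.sum_box_shift`). [cite: Balaban1984PropagatorsI, p.27, (1.72) p.30] -/
theorem sum_box_covDerivFwd_one (η : ℝ) {lam : Site d → 𝔸} (hlam : IsPeriodic P lam) (μ : Fin d) :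
    ∑ x ∈ box (d := d) P, covDerivFwd η (1 : Site d → Fin d → 𝔸ˣ) μ lam x = 0 := by
  simp only [covDerivFwd_flat_apply, ← Finset.smul_sum, Finset.sum_sub_distrib]
  rw [sum_box_shift P hlam (e μ), sub_self, smul_zero]

/-- ★★ **THE CONSTANT PART IS PINNED BY THE CELL AVERAGE**: if `A(x)_μ = (D^η_{1,μ}λ)(x) + v_μ` with `λ` `P`-periodic then
`Pᵈ • v_μ = Σ_{x ∈ [0,P)ᵈ} A(x)_μ` — the harmonic (constant) part of a flat periodic bond field is its torus average, so it vanishes exactly when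
the cell sums of `A` do. [cite: Balaban1984PropagatorsI, (1.72) p.30 («A₀ is a constant vector function»)] -/
theorem card_smul_const_eq_sum_box_of_flat (η : ℝ) {A : Site d → Fin d → 𝔸} {lam : Site d → 𝔸} {v : Fin d → 𝔸} (hlam : IsPeriodic P lam)
    (hdec : ∀ (x : Site d) (μ : Fin d), A x μ = covDerivFwd η (1 : Site d → Fin d → 𝔸ˣ) μ lam x + v μ) (μ : Fin d) :
    (P ^ d) • v μ = ∑ x ∈ box (d := d) P, A x μ := by
  have h : ∑ x ∈ box (d := d) P, A x μ = ∑ x ∈ box (d := d) P, covDerivFwd η (1 : Site d → Fin d → 𝔸ˣ) μ lam x + ∑ x ∈ box (d := d) P, v μ := by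
    rw [← Finset.sum_add_distrib]
    exact Finset.sum_congr rfl fun x _ => hdec x μ
  rw [h, sum_box_covDerivFwd_one P η hlam μ, zero_add, Finset.sum_const, card_box]

/-- ★ **THE POINCARÉ LEMMA WITH THE CONSTANT PINNED**: `A` periodic and flat ⟹ `A = D^η_1λ + v`, `λ` periodic, AND `Pᵈ • v_μ = Σ_{[0,P)ᵈ} A_μ`; in particular
a flat periodic bond field with zero cell sums is a PURE GAUGE `D^η_1λ`. [cite: Balaban1984PropagatorsI, (1.72) p.30; Balaban1985BackgroundPropagators, (3.3)–(3.4) p.391] -/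
theorem exists_periodic_potential_of_flat_of_sum_box_eq_zero (hη : η ≠ 0) {A : Site d → Fin d → 𝔸} (hA : IsPeriodic P A)
    (hflat : ∀ (μ ν : Fin d) (x : Site d), plaqCovDeriv η (1 : Site d → Fin d → 𝔸ˣ) A μ ν x = 0)
    (hsum : ∀ μ : Fin d, ∑ x ∈ box (d := d) P, A x μ = 0) :
    ∃ lam : Site d → 𝔸, IsPeriodic P lam ∧ ∀ (x : Site d) (μ : Fin d), A x μ = covDerivFwd η (1 : Site d → Fin d → 𝔸ˣ) μ lam x := by
  obtain ⟨lam, v, hper, hdec⟩ := exists_periodic_potential_add_const_of_flat P hη hA hflat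
  have hv : ∀ μ, v μ = 0 := fun μ => by
    have h := card_smul_const_eq_sum_box_of_flat P η hper hdec μ
    rw [hsum μ, ← Nat.cast_smul_eq_nsmul ℝ] at h
    have hP : ((P ^ d : ℕ) : ℝ) ≠ 0 := by exact_mod_cast pow_ne_zero d (NeZero.ne P)
    exact (smul_eq_zero.1 h).resolve_left hP
  exact ⟨lam, hper, fun x μ => by rw [hdec x μ, hv μ, add_zero]⟩

/-- **FLATNESS EVERYWHERE FROM FLATNESS ON THE CELL'S PLAQUETTES `ν < κ`** — the index range of dag-n06-b's energy identity `sum_box_pair_Jcur`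
(`Σ_κ Σ_{ν<κ} Σ_{x∈[0,P)ᵈ} |(D^η_{U₀}A)_{νκ}(x)|²`): for a periodic `A` at the flat background, `(D^η_1A)_{νκ}(x) = 0` for `ν < κ`, `x ∈ [0,P)ᵈ` gives it for
all `μ, ν, x` (antisymmetry, empty diagonal, periodicity). [cite: Balaban1985BackgroundPropagators, (3.4) p.391, (3.10) p.392] -/
theorem plaqCovDeriv_one_eq_zero_of_lt_of_mem_box {A : Site d → Fin d → 𝔸} (hA : IsPeriodic P A)
    (h : ∀ (κ : Fin d), ∀ ν ∈ Finset.Iio κ, ∀ x ∈ box (d := d) P, plaqCovDeriv η (1 : Site d → Fin d → 𝔸ˣ) A ν κ x = 0)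
    (μ ν : Fin d) (x : Site d) : plaqCovDeriv η (1 : Site d → Fin d → 𝔸ˣ) A μ ν x = 0 := by
  -- periodicity of the flat plaquette derivative: move `x` into the cell
  have hper : IsPeriodic P (plaqCovDeriv η (1 : Site d → Fin d → 𝔸ˣ) A μ ν) :=
    B9Eq327GreenZdHermPer.isPeriodic_plaqCovDeriv η (fun _ _ => rfl) hA μ ν
  rw [← hper.apply_tlift x]
  have hx : tlift (tcls P x) ∈ box (d := d) P := tlift_mem_box _
  rcases lt_trichotomy μ ν with hlt | rfl | hgt
  · exact h ν μ (Finset.mem_Iio.2 hlt) _ hx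
  · exact plaqCovDeriv_one_self η A μ _
  · rw [plaqCovDeriv_one_swap, h μ ν (Finset.mem_Iio.2 hgt) _ hx, neg_zero]

end Constants

end Literature.MathematicalPhysics.QuantumFieldTheory.Balaban1983to89.B9Eq172FlatCurlPoincareZdPer

end
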